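import Summits.QuantumFields.GaugeBoot.BootstrapSymmetryConsequences
import HarnessLib

/-!
# Reflection positivity as bootstrap cuts: every solution satisfies them (gauge-boot, L1/L3 supplement)

HONEST FRAMING (cell `pub-gaugeboot`, page 1 of every file): the venture produces certified bounds
on lattice expectations at stated coupling, gauge group, dimension and torus size; NOT a mass gap,
NOT a continuum limit, NOT a string tension; NOT Yang–Mills-summit-bearing (barriers
`FixedCouplingUltralocality`, `PerturbativeInvisibility`). Structural; it certifies no number.

## Content

Kazakov–Zheng add REFLECTION-POSITIVITY matrices to the Hermitian positivity of the lattice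
bootstrap (arXiv:2203.11360 §4: site and link reflections; the cell's L3 adds the diagonal
ones). For the untruncated system these cuts are CONSEQUENCES: every solution is the Wilson
expectation (`eq_wilson_of_bootstrap_suN`), and the torus Wilson measure is reflection positive for
the site reflection `Θ'` at EVERY real `β` on even tori (tree
`wilsonExpectation_siteReflectionPositive`, Osterwalder–Seiler).

* `wilson_siteRP_real` — real form of the tree's site RP: `0 ≤ ∫ f(Θ'U) f(U) dμ_Wilson` for every
  continuous real observable `f` of the links of the closed positive half;
* ★★★ `siteRP_of_bootstrap_suN` / `_uN` — every solution `φ` of the untruncated `SU(N)` / `U(N)`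
  bootstrap satisfies `0 ≤ φ ((f ∘ Θ') · f)` for every half-space polynomial `f` (even `L`, any `β`);
  ★★ `siteRPGram_nonneg_of_bootstrap_suN` — quadratic-form version for finite families (the RP
  matrices `(φ((f_j ∘ Θ') f_k))_{jk}` are positive semi-definite on real vectors);
* `rpLevelValuesSuN`, `wilson_mem_rpLevelValues_suN`, ★★ `rpLevelValues_subset_Icc_suN` — adding the
  RP cuts to the word-length-`n` SDP keeps the Wilson value feasible and the bounds converge.

What this is NOT: link / diagonal reflections (same argument with the corresponding tree theorems;
not typed here); odd tori; rates.

References: K. Osterwalder, E. Seiler, Ann. Phys. 110 (1978) 440; V. Kazakov, Z. Zheng,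
arXiv:2203.11360 §4. Folklore.
-/

noncomputable section

open MeasureTheory Filter Topology NormedSpace
open scoped ComplexOrder
open Literature.MathematicalPhysics.QuantumFieldTheory (LatticeRep Site Edge GaugeConfig wilsonAction wilsonMeasure
  wilsonExpectation isProbabilityMeasure_wilsonMeasure wilsonExpectation_siteReflectionPositive)

namespace Summit.QuantumFields.GaugeBoot

/-! ## The Wilson measure: site reflection positivity in real form -/

section Wilson

variable {d L : ℕ} [NeZero d] [NeZero L] {G : Type*} [Group G] [TopologicalSpace G] [IsTopologicalGroup G]
  [CompactSpace G] [MeasurableSpace G] [BorelSpace G] [SecondCountableTopology G]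
  {N : ℕ} (ρ : G →* Matrix (Fin N) (Fin N) ℂ)

/-- **Site reflection positivity of the torus Wilson measure, real form**: for every continuous real
observable `f` of the links of the closed positive-time half, `0 ≤ ∫ f(Θ'U) f(U) dμ_Wilson` (even `L`,
any real `β`; tree `wilsonExpectation_siteReflectionPositive`). [folklore] -/
theorem wilson_siteRP_real (hL : Even L) (hρ : Continuous ρ) (β : ℝ) (f : C(GaugeConfig d L G, ℝ))
    (hdep : DependsOn (⇑f) ((Literature.MathematicalPhysics.QuantumFieldTheory.WilsonSiteRP.sitePosEdges ∪
      Literature.MathematicalPhysics.QuantumFieldTheory.WilsonSiteRP.sharedEdges : Finset (Edge d L)) : Set (Edge d L))) :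
    0 ≤ ∫ U, f (negReflectCM U) * f U ∂(wilsonMeasure (d := d) (L := L) ρ β) := by
  obtain ⟨C, hC⟩ : ∃ C, ∀ U, ‖f U‖ ≤ C :=
    ⟨‖f‖, fun U => f.norm_coe_le_norm U⟩
  have h := wilsonExpectation_siteReflectionPositive ρ hL hρ β (fun U => (f U : ℂ))
    (Complex.continuous_ofReal.comp f.continuous).measurable ⟨C, fun U => by simpa using hC U⟩
    (fun U V hUV => by simp only [hdep hUV])
  simp only [wilsonExpectation, Complex.conj_ofReal, ← Complex.ofReal_mul] at h
  rw [integral_complex_ofReal] at h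
  exact_mod_cast h

end Wilson

/-! ## Every solution satisfies the reflection-positivity cuts -/

section Unitary

open Literature.MathematicalPhysics.QuantumLattice
open Literature.MathematicalPhysics.QuantumFieldTheory.WilsonSiteRP (sitePosEdges sharedEdges)

variable {d L : ℕ} [NeZero d] [NeZero L] (N : ℕ) (β : ℝ)

/-- ★★★ **`SU(N)`: every solution of the untruncated bootstrap is site-reflection positive** —
`0 ≤ φ ((f ∘ Θ') · f)` for every polynomial observable `f` of the links of the closed positive half
(even `L`, any real `β`). [folklore] -/
theorem siteRP_of_bootstrap_suN (hL : Even L)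
    {φ : C(GaugeConfig d L (Matrix.specialUnitaryGroup (Fin N) ℂ), ℝ) →ₗ[ℝ] ℝ} (h1 : φ 1 = 1)
    (hpos : ∀ a ∈ polyAlgebra (ι := Edge d L) (fundamentalLatticeRep N), 0 ≤ φ (a * a))
    (hφ : IsSDFunctional (fundamentalLatticeRep N) (suExp N) (fun _ => wilsonAction (fundamentalRep (Fin N))) β φ)
    {f : C(GaugeConfig d L (Matrix.specialUnitaryGroup (Fin N) ℂ), ℝ)}
    (hf : f ∈ polyAlgebra (ι := Edge d L) (fundamentalLatticeRep N))
    (hdep : DependsOn (⇑f) ((sitePosEdges ∪ sharedEdges : Finset (Edge d L)) : Set (Edge d L))) :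
    0 ≤ φ (f.comp negReflectCM * f) := by
  rw [eq_wilson_of_bootstrap_suN N β h1 hpos hφ
    (Subalgebra.mul_mem _ (comp_negReflectCM_mem_polyAlgebra _ hf) hf)]
  simpa only [ContinuousMap.mul_apply, ContinuousMap.comp_apply] using
    wilson_siteRP_real (fundamentalRep (Fin N)) hL (continuous_fundamentalRep _) β f hdep

/-- ★★★ **`U(N)`: every solution of the untruncated bootstrap is site-reflection positive.**
[folklore] -/
theorem siteRP_of_bootstrap_uN (hL : Even L)
    {φ : C(GaugeConfig d L (Matrix.unitaryGroup (Fin N) ℂ), ℝ) →ₗ[ℝ] ℝ} (h1 : φ 1 = 1)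
    (hpos : ∀ a ∈ polyAlgebra (ι := Edge d L) (unitaryFundamentalLatticeRep N), 0 ≤ φ (a * a))
    (hφ : IsSDFunctional (unitaryFundamentalLatticeRep N) (uExp N)
      (fun _ => wilsonAction (unitaryFundamentalRep (Fin N) ℂ)) β φ)
    {f : C(GaugeConfig d L (Matrix.unitaryGroup (Fin N) ℂ), ℝ)}
    (hf : f ∈ polyAlgebra (ι := Edge d L) (unitaryFundamentalLatticeRep N))
    (hdep : DependsOn (⇑f) ((sitePosEdges ∪ sharedEdges : Finset (Edge d L)) : Set (Edge d L))) :
    0 ≤ φ (f.comp negReflectCM * f) := by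
  rw [eq_wilson_of_bootstrap_uN N β h1 hpos hφ
    (Subalgebra.mul_mem _ (comp_negReflectCM_mem_polyAlgebra _ hf) hf)]
  simpa only [ContinuousMap.mul_apply, ContinuousMap.comp_apply] using
    wilson_siteRP_real (unitaryFundamentalRep (Fin N) ℂ) hL (continuous_unitaryFundamentalRep _ _) β f hdep

/-- ★★ **The RP matrices of a solution are positive semi-definite** (real quadratic-form version): for
half-space polynomials `f_k` and real coefficients `c_k`,
`0 ≤ Σ_{jk} c_j c_k φ((f_j ∘ Θ') f_k)`. [folklore] -/
theorem siteRPGram_nonneg_of_bootstrap_suN (hL : Even L) {κ : Type*} [Fintype κ]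
    {φ : C(GaugeConfig d L (Matrix.specialUnitaryGroup (Fin N) ℂ), ℝ) →ₗ[ℝ] ℝ} (h1 : φ 1 = 1)
    (hpos : ∀ a ∈ polyAlgebra (ι := Edge d L) (fundamentalLatticeRep N), 0 ≤ φ (a * a))
    (hφ : IsSDFunctional (fundamentalLatticeRep N) (suExp N) (fun _ => wilsonAction (fundamentalRep (Fin N))) β φ)
    (f : κ → C(GaugeConfig d L (Matrix.specialUnitaryGroup (Fin N) ℂ), ℝ))
    (hf : ∀ k, f k ∈ polyAlgebra (ι := Edge d L) (fundamentalLatticeRep N))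
    (hdep : ∀ k, DependsOn (⇑(f k)) ((sitePosEdges ∪ sharedEdges : Finset (Edge d L)) : Set (Edge d L)))
    (c : κ → ℝ) :
    0 ≤ ∑ j, ∑ k, c j * c k * φ ((f j).comp negReflectCM * f k) := by
  set g : C(GaugeConfig d L (Matrix.specialUnitaryGroup (Fin N) ℂ), ℝ) := ∑ k, c k • f k with hg
  have hgm : g ∈ polyAlgebra (ι := Edge d L) (fundamentalLatticeRep N) :=
    Subalgebra.sum_mem _ fun k _ => Subalgebra.smul_mem _ (hf k) _
  have hgdep : DependsOn (⇑g) ((sitePosEdges ∪ sharedEdges : Finset (Edge d L)) : Set (Edge d L)) := by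
    intro U V hUV
    simp only [hg, ContinuousMap.coe_sum, ContinuousMap.coe_smul, Finset.sum_apply, Pi.smul_apply]
    exact Finset.sum_congr rfl fun k _ => by rw [hdep k hUV]
  have h := siteRP_of_bootstrap_suN N β hL h1 hpos hφ hgm hgdep
  have hexp : g.comp negReflectCM * g = ∑ j, ∑ k, (c j * c k) • ((f j).comp negReflectCM * f k) := by
    rw [hg, ContinuousMap.ext_iff]
    intro U
    simp only [ContinuousMap.mul_apply, ContinuousMap.comp_apply, ContinuousMap.coe_sum, ContinuousMap.coe_smul,
      Finset.sum_apply, Pi.smul_apply, smul_eq_mul]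
    rw [Finset.sum_mul]
    refine Finset.sum_congr rfl fun j _ => ?_
    rw [Finset.mul_sum]
    refine Finset.sum_congr rfl fun k _ => ?_
    ring
  rw [hexp, map_sum] at h
  simpa only [map_sum, map_smul, smul_eq_mul] using h

/-! ## RP cuts in the truncated SDP -/

/-- **The level-`n` feasible values of `P` with the site-RP cuts added**: level-`n` feasible
functionals (`IsBootstrapFeasible` on the words of length `≤ n`) which moreover satisfy
`0 ≤ φ ((v ∘ Θ') v)` for every level-`n` test function `v` of the closed positive half. [folklore] -/
def rpLevelValuesSuN (n : ℕ) (P : C(GaugeConfig d L (Matrix.specialUnitaryGroup (Fin N) ℂ), ℝ)) : Set ℝ :=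
  {t | ∃ φ : C(GaugeConfig d L (Matrix.specialUnitaryGroup (Fin N) ℂ), ℝ) →ₗ[ℝ] ℝ,
    IsBootstrapFeasible (fundamentalLatticeRep N) (suExp N)
        (fun _ => wilsonAction (fundamentalRep (Fin N))) β
        (wordTruncation (ι := Edge d L) (fundamentalLatticeRep N) n) φ ∧
      (∀ v ∈ wordTruncation (ι := Edge d L) (fundamentalLatticeRep N) n,
        DependsOn (⇑v) ((sitePosEdges ∪ sharedEdges : Finset (Edge d L)) : Set (Edge d L)) →
          0 ≤ φ (v.comp negReflectCM * v)) ∧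
      φ P = t}

/-- The RP cuts shrink the feasible set. -/
theorem rpLevelValues_subset_levelValues (n : ℕ) (P : C(GaugeConfig d L (Matrix.specialUnitaryGroup (Fin N) ℂ), ℝ)) :
    rpLevelValuesSuN (d := d) (L := L) N β n P ⊆ levelValuesSuN (d := d) (L := L) N β n P := by
  rintro t ⟨φ, hφ, -, rfl⟩
  exact ⟨φ, hφ, rfl⟩

/-- ★★ **The Wilson value satisfies the RP cuts at every level** (even `L`). [folklore] -/
theorem wilson_mem_rpLevelValues_suN (hL : Even L) (n : ℕ)
    (P : C(GaugeConfig d L (Matrix.specialUnitaryGroup (Fin N) ℂ), ℝ)) :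
    ∫ U, P U ∂(wilsonMeasure (fundamentalRep (Fin N)) β) ∈ rpLevelValuesSuN (d := d) (L := L) N β n P := by
  haveI : IsProbabilityMeasure (wilsonMeasure (d := d) (L := L) (fundamentalRep (Fin N)) β) :=
    isProbabilityMeasure_wilsonMeasure (ρ := fundamentalRep (Fin N)) (continuous_fundamentalRep _) β
  refine ⟨expectationFunctional (wilsonMeasure (fundamentalRep (Fin N)) β),
    isBootstrapFeasible_wilson_suN N β _ rfl (wordTruncation_subset_polyAlgebra _ n), fun v _ hdep => ?_, rfl⟩
  rw [expectationFunctional_apply]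
  simpa only [ContinuousMap.mul_apply, ContinuousMap.comp_apply] using
    wilson_siteRP_real (fundamentalRep (Fin N)) hL (continuous_fundamentalRep _) β v hdep

/-- ★★ **The SDP bounds with RP cuts converge to the Wilson value** (even `L`). [folklore] -/
theorem rpLevelValues_subset_Icc_suN {P : C(GaugeConfig d L (Matrix.specialUnitaryGroup (Fin N) ℂ), ℝ)}
    (hP : P ∈ polyAlgebra (ι := Edge d L) (fundamentalLatticeRep N)) {ε : ℝ} (hε : 0 < ε) :
    ∀ᶠ n in atTop, rpLevelValuesSuN (d := d) (L := L) N β n P ⊆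
      Set.Icc (∫ U, P U ∂(wilsonMeasure (fundamentalRep (Fin N)) β) - ε)
        (∫ U, P U ∂(wilsonMeasure (fundamentalRep (Fin N)) β) + ε) := by
  filter_upwards [levelValues_subset_Icc_suN N β hP hε] with n hn
  exact (rpLevelValues_subset_levelValues N β n P).trans hn

end Unitary

end Summit.QuantumFields.GaugeBoot

end
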